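/-
Copyright: harness cell b2b-lgcu-borel (gen 19).  Honest framing: the VALUE here is a THEOREM
(the prime `2` is closed at level one in EVERY dimension and at EVERY exponent) — NOT summit
progress; the crux item `SubgroupIdentityDesigns` (stmt-MatrixMultiplication-14079) stays open
and untouched.
-/
import Mathlib
import Summits.MatrixMultiplication.MatrixMultiplication.Theorems.SubgroupIdentityDesigns.Negative.LevelOneDimSqueeze

/-!
# The prime `2` hosts no level-one witness of the crux, in any dimension, at any exponent

Route `LevelGradedCohnUmans`, crux `SubgroupIdentityDesigns`, negative side, the `(m,1)` cells at
`p = 2` for ALL `m = 1 + l ≥ 2` and ALL `ε > 0`.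

`LevelOneDimSqueeze.no_levelOne_witness_dim` excludes a level-one witness in `GL_{1+l}(𝔽_p)` as
soon as the exact-dimension master inequality fails, i.e. as soon as
`(1 + a² + (p−2) b²)^{s/2} ≤ (1 + a^s + (p−2) b^s) · 2^{s/6}`, `s = 2 + ε`,
`a = (p^{1+l} − p)/(p − 1)`, `b = (p^{1+l} − 1)/(p − 1)`.  Its docstring records this cell-wise
only for `ε < 2` at `(p,m) = (2,2), (2,3)` and uniformly only for `ε ≤ ε₃(2) = 1`.  At `p = 2` the
`b`-terms vanish (`p − 2 = 0`) and the inequality holds for EVERY `s ≥ 0` and EVERY `l ≥ 1`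
(`pTwo_threshold`): with `a = 2^{1+l} − 2 ≥ 2`,
`(1 + a²)^{s/2} ≤ ((5/4) a²)^{s/2} = (125/64)^{s/6} a^s ≤ 2^{s/6} (1 + a^s)`.
Hence (`no_levelOne_witness_pTwo`, `no_crux_instance_pTwo`, `no_crux_instance_pTwo_all`):

**for every `l ≥ 1` and every `ε > 0`, no subgroup triple of `GL_{1+l}(𝔽_2)` is a level-one
witness of `SubgroupIdentityDesigns`** — the prime `2` is closed at level one, uniformly in the
dimension and in the exponent (walls `2V² ≤ (dim F_1)³` against the exact floor; no TPP structure,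
no census).  This supersedes, at `p = 2`, the data verdicts of the `GL₂(𝔽₂)` / `GL₃(𝔽₂)` level-one
censuses (gens 7, 18) for what concerns the crux inequality.

Sorry-free; standard axioms; no new definitions.  Report:
`run/shared/lean/b2b/levelgraded-cu/ORACLE-g19.md` §G19-1.
-/

set_option linter.dupNamespace false

noncomputable section

open scoped BigOperators Classical Matrix

namespace Summit.MatrixMultiplication.MatrixMultiplication.Theorems.SubgroupIdentityDesigns.Negative
namespace PTwoAllDimensions

open Literature.Barriers.MatrixMultiplication (SubgroupTPP)
open Summit.MatrixMultiplication.MatrixMultiplication.Theorems.LieRankDesigns.Negative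
  (GLm Mat budget)
open LevelOneDimSqueeze (no_levelOne_witness_dim)

variable {l : ℕ}

/-- The numerical heart: `(125/64)^{s/6} ≤ 2^{s/6}`, i.e. `(5/4)^{s/2} ≤ 2^{s/6}` for `s ≥ 0`. -/
theorem five_fourths_rpow_le {s : ℝ} (hs : 0 ≤ s) :
    ((5 : ℝ) / 4) ^ (s / 2) ≤ (2 : ℝ) ^ (s / 6) := by
  have e : ((5 : ℝ) / 4) ^ (s / 2) = (((5 : ℝ) / 4) ^ (3 : ℝ)) ^ (s / 6) := by
    rw [← Real.rpow_mul (by norm_num : (0 : ℝ) ≤ 5 / 4)]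
    congr 1
    ring
  rw [e]
  refine Real.rpow_le_rpow (Real.rpow_nonneg (by norm_num) _) ?_ (by linarith)
  rw [show (3 : ℝ) = ((3 : ℕ) : ℝ) by norm_num, Real.rpow_natCast]
  norm_num

/-- **The `p = 2` threshold holds for every `s ≥ 0` and every `l ≥ 1`.**  With
`a = 2^{1+l} − 2 ≥ 2`: `(1 + a²)^{s/2} ≤ (1 + a^s) · 2^{s/6}` (the `(p − 2)`-terms vanish). -/
theorem pTwo_threshold (hl : 1 ≤ l) {s : ℝ} (hs : 0 ≤ s) :
    (1 + ((((2 : ℕ) : ℝ) ^ (1 + l) - (2 : ℕ)) / (((2 : ℕ) : ℝ) - 1)) ^ 2 +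
        (((2 : ℕ) : ℝ) - 2) * ((((2 : ℕ) : ℝ) ^ (1 + l) - 1) / (((2 : ℕ) : ℝ) - 1)) ^ 2) ^ (s / 2) ≤
      (1 + ((((2 : ℕ) : ℝ) ^ (1 + l) - (2 : ℕ)) / (((2 : ℕ) : ℝ) - 1)) ^ s +
          (((2 : ℕ) : ℝ) - 2) * ((((2 : ℕ) : ℝ) ^ (1 + l) - 1) / (((2 : ℕ) : ℝ) - 1)) ^ s) *
        (2 : ℝ) ^ (s / 6) := by
  have h4 : (4 : ℝ) ≤ (2 : ℝ) ^ (1 + l) := by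
    have h := pow_le_pow_right₀ (show (1 : ℝ) ≤ 2 by norm_num) (show 2 ≤ 1 + l by omega)
    norm_num at h
    exact h
  set a : ℝ := (2 : ℝ) ^ (1 + l) - 2 with ha
  have ha2 : 2 ≤ a := by rw [ha]; linarith
  have ha0 : 0 ≤ a := by linarith
  have hsimp : ((((2 : ℕ) : ℝ) ^ (1 + l) - (2 : ℕ)) / (((2 : ℕ) : ℝ) - 1)) = a := by
    push_cast
    rw [ha]
    norm_num
  have hzero : (((2 : ℕ) : ℝ) - 2) = 0 := by push_cast; ring
  rw [hsimp, hzero, zero_mul, zero_mul, add_zero, add_zero]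
  -- `(1 + a²)^{s/2} ≤ ((5/4) a²)^{s/2} = (5/4)^{s/2} a^s ≤ 2^{s/6} a^s ≤ 2^{s/6} (1 + a^s)`
  have hsq : 1 + a ^ 2 ≤ 5 / 4 * a ^ 2 := by nlinarith
  have h1 : (1 + a ^ 2) ^ (s / 2) ≤ (5 / 4 * a ^ 2) ^ (s / 2) :=
    Real.rpow_le_rpow (by positivity) hsq (by linarith)
  have h2 : (5 / 4 * a ^ 2) ^ (s / 2) = ((5 : ℝ) / 4) ^ (s / 2) * a ^ s := by
    rw [Real.mul_rpow (by norm_num) (by positivity)]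
    congr 1
    rw [show a ^ 2 = a ^ ((2 : ℕ) : ℝ) by rw [Real.rpow_natCast], ← Real.rpow_mul ha0]
    congr 1
    push_cast
    ring
  have has : 0 ≤ a ^ s := Real.rpow_nonneg ha0 s
  have h3 : ((5 : ℝ) / 4) ^ (s / 2) * a ^ s ≤ (2 : ℝ) ^ (s / 6) * a ^ s :=
    mul_le_mul_of_nonneg_right (five_fourths_rpow_le hs) has
  have h4' : (2 : ℝ) ^ (s / 6) * a ^ s ≤ (1 + a ^ s) * (2 : ℝ) ^ (s / 6) := by
    rw [mul_comm]
    exact mul_le_mul_of_nonneg_right (by linarith) (Real.rpow_nonneg (by norm_num) _)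
  calc (1 + a ^ 2) ^ (s / 2) ≤ (5 / 4 * a ^ 2) ^ (s / 2) := h1
    _ = ((5 : ℝ) / 4) ^ (s / 2) * a ^ s := h2
    _ ≤ (2 : ℝ) ^ (s / 6) * a ^ s := h3
    _ ≤ (1 + a ^ s) * (2 : ℝ) ^ (s / 6) := h4'

/-- **NO LEVEL-ONE WITNESS OVER `𝔽_2`, ANY DIMENSION, ANY EXPONENT.**  For every `l ≥ 1` and every
`ε > 0`: a subgroup-TPP triple of `GL_{1+l}(𝔽_2)` carrying a level-one identity design never
satisfies the crux inequality `budget 2 (1+l) 1 (2+ε) < (|H₁||H₂||H₃|)^{(2+ε)/3}`. -/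
theorem no_levelOne_witness_pTwo (hl : 1 ≤ l) {ε : ℝ} (hε : 0 < ε)
    {H₁ H₂ H₃ : Subgroup (GLm 2 (1 + l))} (htpp : SubgroupTPP H₁ H₂ H₃)
    (hdes : ∃ c : Mat 2 (1 + l) → ℂ, (∀ M, 1 < M.rank → c M = 0) ∧
      (∑ M, c M * ZMod.stdAddChar (Matrix.trace (M * ((1 : GLm 2 (1 + l)) : Mat 2 (1 + l))))) = 1 ∧
      ∀ a ∈ H₁, ∀ b ∈ H₂, ∀ g ∈ H₃, a * b * g ≠ 1 →
        (∑ M, c M * ZMod.stdAddChar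
          (Matrix.trace (M * ((a * b * g : GLm 2 (1 + l)) : Mat 2 (1 + l))))) = 0) :
    ¬ budget 2 (1 + l) 1 (2 + ε) <
      ((Nat.card H₁ * Nat.card H₂ * Nat.card H₃ : ℕ) : ℝ) ^ ((2 + ε) / 3) :=
  no_levelOne_witness_dim (p := 2) hl hε (pTwo_threshold hl (by linarith)) htpp hdes

/-- **The crux clause verbatim at `(p, m, k) = (2, 1 + l, 1)` has no instance** (`l ≥ 1`, `ε > 0`). -/
theorem no_crux_instance_pTwo (hl : 1 ≤ l) {ε : ℝ} (hε : 0 < ε)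
    (H₁ H₂ H₃ : Subgroup (Matrix.GeneralLinearGroup (Fin (1 + l)) (ZMod 2))) :
    ¬ (Literature.Barriers.MatrixMultiplication.SubgroupTPP H₁ H₂ H₃ ∧
      (∃ c : Matrix (Fin (1 + l)) (Fin (1 + l)) (ZMod 2) → ℂ, (∀ M, 1 < M.rank → c M = 0) ∧
        (∑ M : Matrix (Fin (1 + l)) (Fin (1 + l)) (ZMod 2), c M * ZMod.stdAddChar
          (Matrix.trace (M * ((1 : Matrix.GeneralLinearGroup (Fin (1 + l)) (ZMod 2)) :
            Matrix (Fin (1 + l)) (Fin (1 + l)) (ZMod 2))))) = 1 ∧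
        ∀ a ∈ H₁, ∀ b ∈ H₂, ∀ g ∈ H₃, a * b * g ≠ 1 →
          (∑ M : Matrix (Fin (1 + l)) (Fin (1 + l)) (ZMod 2), c M * ZMod.stdAddChar
            (Matrix.trace (M * ((a * b * g : Matrix.GeneralLinearGroup (Fin (1 + l)) (ZMod 2)) :
              Matrix (Fin (1 + l)) (Fin (1 + l)) (ZMod 2))))) = 0) ∧
      (∑ᶠ χ ∈ Literature.RepresentationTheory.FiniteGroups.irrChars
          (Matrix.GeneralLinearGroup (Fin (1 + l)) (ZMod 2)) ∩
          {f | ∃ c : Matrix (Fin (1 + l)) (Fin (1 + l)) (ZMod 2) → ℂ,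
            (∀ M, 1 < M.rank → c M = 0) ∧
            ∀ g : Matrix.GeneralLinearGroup (Fin (1 + l)) (ZMod 2), f g =
              ∑ M : Matrix (Fin (1 + l)) (Fin (1 + l)) (ZMod 2), c M * ZMod.stdAddChar
                (Matrix.trace (M * (g : Matrix (Fin (1 + l)) (Fin (1 + l)) (ZMod 2))))},
        (χ 1).re ^ (2 + ε)) <
        ((Nat.card H₁ * Nat.card H₂ * Nat.card H₃ : ℕ) : ℝ) ^ ((2 + ε) / 3)) := by
  rintro ⟨htpp, hdesign, hlt⟩
  exact no_levelOne_witness_pTwo hl hε htpp hdesign hlt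

/-- **Packaged over all dimensions `m ≥ 2`**: for every `ε > 0` there is no `m ≥ 2` and no
subgroup triple of `GL_m(𝔽_2)` witnessing `SubgroupIdentityDesigns` at level `k = 1`. -/
theorem no_crux_instance_pTwo_all {ε : ℝ} (hε : 0 < ε) :
    ¬ ∃ (m : ℕ) (_ : 2 ≤ m)
      (H₁ H₂ H₃ : Subgroup (Matrix.GeneralLinearGroup (Fin m) (ZMod 2))),
      Literature.Barriers.MatrixMultiplication.SubgroupTPP H₁ H₂ H₃ ∧
      (∃ c : Matrix (Fin m) (Fin m) (ZMod 2) → ℂ, (∀ M, 1 < M.rank → c M = 0) ∧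
        (∑ M : Matrix (Fin m) (Fin m) (ZMod 2), c M * ZMod.stdAddChar
          (Matrix.trace (M * ((1 : Matrix.GeneralLinearGroup (Fin m) (ZMod 2)) :
            Matrix (Fin m) (Fin m) (ZMod 2))))) = 1 ∧
        ∀ a ∈ H₁, ∀ b ∈ H₂, ∀ g ∈ H₃, a * b * g ≠ 1 →
          (∑ M : Matrix (Fin m) (Fin m) (ZMod 2), c M * ZMod.stdAddChar
            (Matrix.trace (M * ((a * b * g : Matrix.GeneralLinearGroup (Fin m) (ZMod 2)) :
              Matrix (Fin m) (Fin m) (ZMod 2))))) = 0) ∧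
      (∑ᶠ χ ∈ Literature.RepresentationTheory.FiniteGroups.irrChars
          (Matrix.GeneralLinearGroup (Fin m) (ZMod 2)) ∩
          {f | ∃ c : Matrix (Fin m) (Fin m) (ZMod 2) → ℂ, (∀ M, 1 < M.rank → c M = 0) ∧
            ∀ g : Matrix.GeneralLinearGroup (Fin m) (ZMod 2), f g =
              ∑ M : Matrix (Fin m) (Fin m) (ZMod 2), c M * ZMod.stdAddChar
                (Matrix.trace (M * (g : Matrix (Fin m) (Fin m) (ZMod 2))))},
        (χ 1).re ^ (2 + ε)) <
        ((Nat.card H₁ * Nat.card H₂ * Nat.card H₃ : ℕ) : ℝ) ^ ((2 + ε) / 3) := by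
  rintro ⟨m, hm, H₁, H₂, H₃, h⟩
  obtain ⟨l, rfl⟩ : ∃ l, m = 1 + l := ⟨m - 1, by omega⟩
  exact no_crux_instance_pTwo (by omega) hε H₁ H₂ H₃ h

end PTwoAllDimensions

end Summit.MatrixMultiplication.MatrixMultiplication.Theorems.SubgroupIdentityDesigns.Negative
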